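import Summits.CriticalPhenomena.PercolationContinuityZ3.Theorems.PercNearOneGluingNoHeavyLowerTailThreePointLBSwitchingClusters
import Literature.Probability.Percolation.DecisionTreeThreeConfig
import Mathlib.Tactic.FinCases
import HarnessLib

/-!
# `NoHeavyLowerTail` (stmt-CriticalPhenomena-4575) — three-point lower bound `3PT-LB = SHK3⁺` by four switchings, II:
# the four switchings `Φ₁ … Φ₄` preserve `μ ⊗ μ ⊗ μ`; box events factorise

Support file (prover prim-cert-2; `--supports stmt-CriticalPhenomena-4575`).  No named facts, no sorries.

The four three-copy switchings of prim-lit-2's proof of `3PT-LB` (PROOF-3PTLB.md), on triples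
`x = (X, Y, Z) = (x 0, x 1, x 2)` of configurations `Finset (Sym2 V)`, with `A = cl X a`, `B = cl X b` and
`splice F K₁ K₂ =` (`K₁` on `F`, `K₂` off `F`):
* `Φ₁(X,Y,Z) = (Y_{touch A} X, X_{touch A} Y, Z)` — explore `K_a(X)`, exchange `X ↔ Y` on its pairs;
* `Φ₂(X,Y,Z) = (Z_{touch B} X, Y, X_{touch B} Z)` — explore `K_b(X)`, exchange `X ↔ Z` there;
* `Φ₃(X,Y,Z) = (Y_{touch A} Z_{touch B ∖ touch A} X, X_{touch A} Y, X_{touch B ∖ touch A} Z)`;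
* `Φ₄(X,Y,Z) = (Z_{touch B} Y_{touch A ∖ touch B} X, X_{touch A ∖ touch B} Y, X_{touch B} Z)`.
All four are instances of the tree's two-region switching `DecisionTree.splice3 R S` (region `R(x₀)` of copy `0`
to copy `1`, region `S(x₀)` to copy `2`) [GladkovZimin2024, Lemma 4.2 / Thm 4.6, three-copy form;
`DecisionTree.sum_wt3W_comp_splice3`], `Φ₄` after exchanging the roles of copies `1` and `2`; the regions are
self-determined because a cluster is determined by the pairs meeting it (`Gladkov.selfDetermined_touch_cl`).
Hence each `Φᵢ` preserves the triple law: `sum_wt3W_phi1` … `sum_wt3W_phi4`.  Finally `box E₀ E₁ E₂` is the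
product event `{x | x 0 ∈ E₀ ∧ x 1 ∈ E₁ ∧ x 2 ∈ E₂}` and `sum_wt3W_ind_box` its factorisation
`E[1_box] = PrW E₀ · PrW E₁ · PrW E₂` (`DTree3.Pr3W_pi`).
-/

noncomputable section

namespace Summit.CriticalPhenomena.PercolationContinuityZ3.Theorems

namespace ThreePointLB

open Finset Literature.Probability.Percolation Literature.Probability.Percolation.DecisionTree
open Literature.Probability.Percolation.Gladkov
open scoped Classical

variable {V : Type*} [Fintype V] [DecidableEq V]

/-! ### The four switchings -/

/-- `Φ₁(X,Y,Z) = (Y on touch A | X, X on touch A | Y, Z)`, `A = cl X a`: explore the cluster of `a` in copy `0`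
and exchange copies `0` and `1` on the pairs meeting it. [cite: GladkovZimin2024, Example 4.4 (three-copy form)] -/
def phi1 (a : V) : (Fin 3 → Finset (Sym2 V)) → (Fin 3 → Finset (Sym2 V)) :=
  splice3 (fun K => touch (cl K a)) (fun _ => ∅)

/-- `Φ₂(X,Y,Z) = (Z on touch B | X, Y, X on touch B | Z)`, `B = cl X b`: explore the cluster of `b` in copy `0`
and exchange copies `0` and `2` there. [cite: GladkovZimin2024, Example 4.4 (three-copy form)] -/
def phi2 (b : V) : (Fin 3 → Finset (Sym2 V)) → (Fin 3 → Finset (Sym2 V)) :=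
  splice3 (fun _ => ∅) (fun K => touch (cl K b))

/-- `Φ₃(X,Y,Z) = (Y on touch A, Z on touch B ∖ touch A, X elsewhere; X on touch A | Y; X on touch B ∖ touch A | Z)`:
`Φ₁`'s exploration, then explore the cluster of `b` in copy `0` on the not-yet-used pairs and exchange copies
`0` and `2` there. [cite: GladkovZimin2024, proof of Thm. 4.6 (successive explorations; three-copy form)] -/
def phi3 (a b : V) : (Fin 3 → Finset (Sym2 V)) → (Fin 3 → Finset (Sym2 V)) :=
  splice3 (fun K => touch (cl K a)) (fun K => touch (cl K b) \ touch (cl K a))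

/-- `Φ₄(X,Y,Z) = (Z on touch B, Y on touch A ∖ touch B, X elsewhere; X on touch A ∖ touch B | Y; X on touch B | Z)`:
the same with the two explorations in the other order (the two-region switching with the roles of copies `1`
and `2` exchanged). [cite: GladkovZimin2024, proof of Thm. 4.6 (successive explorations; three-copy form)] -/
def phi4 (a b : V) (x : Fin 3 → Finset (Sym2 V)) : Fin 3 → Finset (Sym2 V) := fun k =>
  splice3 (fun K => touch (cl K b)) (fun K => touch (cl K a) \ touch (cl K b))
    (fun i => x (Equiv.swap 1 2 i)) (Equiv.swap 1 2 k)

omit [Fintype V] in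
/-- `splice ∅ K₁ K₂ = K₂`. [folklore] -/
theorem splice_empty (K₁ K₂ : Finset (Sym2 V)) : splice ∅ K₁ K₂ = K₂ := by
  ext e; simp [mem_splice]

section Outputs

variable (a b : V) (x : Fin 3 → Finset (Sym2 V))

/-- Output `0` of `Φ₁`. [folklore] -/
@[simp] theorem phi1_zero : phi1 a x 0 = splice (touch (cl (x 0) a)) (x 1) (x 0) := by
  rw [phi1, splice3_zero, splice_empty]
/-- Output `1` of `Φ₁`. [folklore] -/
@[simp] theorem phi1_one : phi1 a x 1 = splice (touch (cl (x 0) a)) (x 0) (x 1) := by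
  rw [phi1, splice3_one]
/-- Output `2` of `Φ₁`. [folklore] -/
@[simp] theorem phi1_two : phi1 a x 2 = x 2 := by
  rw [phi1, splice3_two, splice_empty]
/-- Output `0` of `Φ₂`. [folklore] -/
@[simp] theorem phi2_zero : phi2 b x 0 = splice (touch (cl (x 0) b)) (x 2) (x 0) := by
  rw [phi2, splice3_zero, splice_empty]
/-- Output `1` of `Φ₂`. [folklore] -/
@[simp] theorem phi2_one : phi2 b x 1 = x 1 := by
  rw [phi2, splice3_one, splice_empty]
/-- Output `2` of `Φ₂`. [folklore] -/
@[simp] theorem phi2_two : phi2 b x 2 = splice (touch (cl (x 0) b)) (x 0) (x 2) := by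
  rw [phi2, splice3_two]
/-- Output `0` of `Φ₃`. [folklore] -/
@[simp] theorem phi3_zero : phi3 a b x 0 =
    splice (touch (cl (x 0) a)) (x 1) (splice (touch (cl (x 0) b) \ touch (cl (x 0) a)) (x 2) (x 0)) := by
  rw [phi3, splice3_zero]
/-- Output `1` of `Φ₃`. [folklore] -/
@[simp] theorem phi3_one : phi3 a b x 1 = splice (touch (cl (x 0) a)) (x 0) (x 1) := by
  rw [phi3, splice3_one]
/-- Output `2` of `Φ₃`. [folklore] -/
@[simp] theorem phi3_two : phi3 a b x 2 = splice (touch (cl (x 0) b) \ touch (cl (x 0) a)) (x 0) (x 2) := by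
  rw [phi3, splice3_two]

/-- `(1 2)` fixes `0` in `Fin 3`. [folklore] -/
private theorem swap12_0 : (Equiv.swap (1 : Fin 3) 2) 0 = 0 := by decide
/-- `(1 2)` sends `1 ↦ 2` in `Fin 3`. [folklore] -/
private theorem swap12_1 : (Equiv.swap (1 : Fin 3) 2) 1 = 2 := by decide
/-- `(1 2)` sends `2 ↦ 1` in `Fin 3`. [folklore] -/
private theorem swap12_2 : (Equiv.swap (1 : Fin 3) 2) 2 = 1 := by decide

/-- Output `0` of `Φ₄`. [folklore] -/
@[simp] theorem phi4_zero : phi4 a b x 0 =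
    splice (touch (cl (x 0) b)) (x 2) (splice (touch (cl (x 0) a) \ touch (cl (x 0) b)) (x 1) (x 0)) := by
  simp only [phi4, swap12_0, splice3_zero, swap12_1, swap12_2]
/-- Output `1` of `Φ₄`. [folklore] -/
@[simp] theorem phi4_one : phi4 a b x 1 = splice (touch (cl (x 0) a) \ touch (cl (x 0) b)) (x 0) (x 1) := by
  simp only [phi4, swap12_1, splice3_two, swap12_0, swap12_2]
/-- Output `2` of `Φ₄`. [folklore] -/
@[simp] theorem phi4_two : phi4 a b x 2 = splice (touch (cl (x 0) b)) (x 0) (x 2) := by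
  simp only [phi4, swap12_2, splice3_one, swap12_0, swap12_1]

end Outputs

/-! ### Each switching preserves the triple law -/

section Law

variable (p : Sym2 V → ℝ) (D : Finset (Sym2 V)) (a b : V) (f : (Fin 3 → Finset (Sym2 V)) → ℝ)

/-- The second region of `Φ₃`/`Φ₄` is determined on the union of the two regions. [folklore] -/
theorem touch_sdiff_congr (a b : V) (K K' : Finset (Sym2 V))
    (h : ∀ i ∈ touch (cl K a) ∪ (touch (cl K b) \ touch (cl K a)), (i ∈ K ↔ i ∈ K')) :
    touch (cl K' b) \ touch (cl K' a) = touch (cl K b) \ touch (cl K a) := by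
  have ha : cl K' a = cl K a := cl_eq_of_agree fun e he => h e (Finset.mem_union_left _ he)
  have hb : cl K' b = cl K b := by
    refine cl_eq_of_agree fun e he => h e ?_
    by_cases he' : e ∈ touch (cl K a)
    · exact Finset.mem_union_left _ he'
    · exact Finset.mem_union_right _ (Finset.mem_sdiff.2 ⟨he, he'⟩)
  rw [ha, hb]

/-- **`Φ₁` preserves `μ ⊗ μ ⊗ μ`.** [cite: GladkovZimin2024, Lemma 4.2 and Example 4.4] -/
theorem sum_wt3W_phi1 :
    ∑ x ∈ triples D, wt3W D p x * f (phi1 a x) = ∑ x ∈ triples D, wt3W D p x * f x := by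
  unfold phi1
  exact sum_wt3W_comp_splice3 p (selfDetermined_touch_cl a) (fun K => Finset.disjoint_empty_left _)
    (fun _ _ _ => rfl) D f

/-- **`Φ₂` preserves `μ ⊗ μ ⊗ μ`.** [cite: GladkovZimin2024, Lemma 4.2 and Example 4.4] -/
theorem sum_wt3W_phi2 :
    ∑ x ∈ triples D, wt3W D p x * f (phi2 b x) = ∑ x ∈ triples D, wt3W D p x * f x := by
  unfold phi2
  refine sum_wt3W_comp_splice3 p (fun _ _ _ => rfl) (fun K => Finset.disjoint_empty_right _)
    (fun K K' h => ?_) D f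
  rw [cl_eq_of_agree fun e he => h e (Finset.mem_union_right _ he)]

/-- **`Φ₃` preserves `μ ⊗ μ ⊗ μ`.** [cite: GladkovZimin2024, Lemma 4.2 and proof of Thm. 4.6] -/
theorem sum_wt3W_phi3 :
    ∑ x ∈ triples D, wt3W D p x * f (phi3 a b x) = ∑ x ∈ triples D, wt3W D p x * f x := by
  unfold phi3
  exact sum_wt3W_comp_splice3 p (selfDetermined_touch_cl a) (fun K => Finset.sdiff_disjoint)
    (touch_sdiff_congr a b) D f

/-- **`Φ₄` preserves `μ ⊗ μ ⊗ μ`** (the two-region switching conjugated by the exchange of copies `1, 2`,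
which preserves weights). [cite: GladkovZimin2024, Lemma 4.2 and proof of Thm. 4.6] -/
theorem sum_wt3W_phi4 :
    ∑ x ∈ triples D, wt3W D p x * f (phi4 a b x) = ∑ x ∈ triples D, wt3W D p x * f x := by
  set σ : Equiv.Perm (Fin 3) := Equiv.swap 1 2 with hσ
  set R : Finset (Sym2 V) → Finset (Sym2 V) := fun K => touch (cl K b) with hR
  set S : Finset (Sym2 V) → Finset (Sym2 V) := fun K => touch (cl K a) \ touch (cl K b) with hS
  have hphi : ∀ x, phi4 a b x = fun k => splice3 R S (fun i => x (σ i)) (σ k) := fun x => rfl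
  calc ∑ x ∈ triples D, wt3W D p x * f (phi4 a b x)
      = ∑ x ∈ triples D, (fun y => wt3W D p y * f (fun k => splice3 R S y (σ k))) (fun i => x (σ i)) := by
        refine Finset.sum_congr rfl fun x _ => ?_
        simp only [hphi, DTree3.wt3W_comp_perm]
    _ = ∑ y ∈ triples D, wt3W D p y * f (fun k => splice3 R S y (σ k)) :=
        DTree3.sum_triples_comp_perm D σ (fun y => wt3W D p y * f (fun k => splice3 R S y (σ k)))
    _ = ∑ y ∈ triples D, wt3W D p y * f (fun k => y (σ k)) :=
        sum_wt3W_comp_splice3 p (selfDetermined_touch_cl b) (fun K => Finset.sdiff_disjoint)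
          (touch_sdiff_congr b a) D (fun y => f (fun k => y (σ k)))
    _ = ∑ y ∈ triples D, wt3W D p y * f y := by
        have h := DTree3.sum_triples_comp_perm D σ (fun y => wt3W D p y * f y)
        simpa only [DTree3.wt3W_comp_perm] using h

end Law

/-! ### Box (product) events of the triple space -/

/-- The product event `{x | x 0 ∈ E₀, x 1 ∈ E₁, x 2 ∈ E₂}` of the triple space. [folklore] -/
def box (E₀ E₁ E₂ : Set (Finset (Sym2 V))) : Set (Fin 3 → Finset (Sym2 V)) :=
  {x | x 0 ∈ E₀ ∧ x 1 ∈ E₁ ∧ x 2 ∈ E₂}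

omit [Fintype V] [DecidableEq V] in
/-- Membership in `box`. [folklore] -/
@[simp] theorem mem_box {E₀ E₁ E₂ : Set (Finset (Sym2 V))} {x : Fin 3 → Finset (Sym2 V)} :
    x ∈ box E₀ E₁ E₂ ↔ x 0 ∈ E₀ ∧ x 1 ∈ E₁ ∧ x 2 ∈ E₂ := Iff.rfl

omit [Fintype V] in
/-- **Box events factorise**: `Σ_x wt3W x · 1_{box E₀ E₁ E₂}(x) = PrW E₀ · PrW E₁ · PrW E₂`. [folklore] -/
theorem sum_wt3W_ind_box (p : Sym2 V → ℝ) (D : Finset (Sym2 V)) (E₀ E₁ E₂ : Set (Finset (Sym2 V))) :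
    ∑ x ∈ triples D, wt3W D p x * ind (box E₀ E₁ E₂) x = PrW D p E₀ * PrW D p E₁ * PrW D p E₂ := by
  have hset : box E₀ E₁ E₂ = {x | ∀ i, x i ∈ (![E₀, E₁, E₂] : Fin 3 → Set (Finset (Sym2 V))) i} := by
    ext x
    simp only [mem_box, Set.mem_setOf_eq, Fin.forall_fin_succ]
    simp
  rw [← Pr3W_eq_sum_ind, hset, DTree3.Pr3W_pi, Fin.prod_univ_three]
  simp

end ThreePointLB

end Summit.CriticalPhenomena.PercolationContinuityZ3.Theorems

end
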